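import Literature.Computability.AlgebraicComplexity.AlperBogartVelascoBoxFour
import HarnessLib

/-!
# Route `SymPencil` — `7`-dimensional linear subspaces of `Sing Z(per_4)`, III: the cross in canonical position
# (`--supports` stmt-ValiantsHypothesis-5674 `SdcSuperquadratic`; towards the sizes `m = 21, 22`)

`le_cross_of_column_three`: a `7`-dimensional space `W` of `4 × 4` matrices with vanishing `3 × 3`
minor-permanents, whose row `3` maps onto `K⁴` and which contains the matrix units
`E₀₃, E₁₃, E₂₃` (up to scalars), is contained in the CROSS `X₃₃ = {support ⊂ row 3 ∪ column 3}`
(hence equal to it, both having dimension `7`).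

Proof.  `{x ∈ W : row_3 x = 0} = ⟨E₀₃, E₁₃, E₂₃⟩` by dimension (`7 = 4 + 3`).  For `b ≠ a` in
`{0,1,2}` the cubic on rows `(a, b, 3)` of `E_{a3} + x` minus that of `x` is
`T_c(e₃, row_b x, row_3 x)`, i.e. the three pairings of `(x_{b0}, x_{b1}, x_{b2})` with
`(x_{30}, x_{31}, x_{32})` vanish for every `x ∈ W`; evaluated on sections `row_3 x^{(m)} = e_m`
and on their pairwise sums this forces `x^{(m)}_{bj} = 0` (`j < 3`), and every `x ∈ W` is
`Σ_m x_{3m} x^{(m)}` modulo `⟨E₀₃, E₁₃, E₂₃⟩`. [folklore]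
-/

noncomputable section

-- single-conjunct layout: Sub = Summit, duplicated namespace component intended
set_option linter.dupNamespace false

namespace Summit.ValiantsHypothesis.ValiantsHypothesis.Theorems.SymPencilBoxFourCrossLe

open Module Finset
open Literature.Computability.AlgebraicComplexity
open Literature.Computability.AlgebraicComplexity.AlperBogartVelasco

variable {K : Type*} [Field K]

/-- **A full row `3` together with the units `E₀₃, E₁₃, E₂₃` forces `W ≤ X₃₃`.**  See the module
docstring. [folklore] -/
theorem le_cross_of_column_three [CharZero K] (W : Submodule K (Fin 4 × Fin 4 → K))
    (hW : ∀ x ∈ W, ∀ (r c : Fin 3 → Fin 4), Function.Injective r → Function.Injective c →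
      ((Matrix.of fun i j => x (i, j)).submatrix r c).permanent = 0)
    (h7 : finrank K W = 7)
    (hR : finrank K ↥(W.map (LinearMap.funLeft K K fun j : Fin 4 => ((3 : Fin 4), j))) = 4)
    (hz : ∀ a : Fin 4, a ≠ 3 → ∃ z ∈ W, z (a, 3) ≠ 0 ∧ ∀ p, p ≠ (a, 3) → z p = 0) :
    ∀ x ∈ W, ∀ i j : Fin 4, i ≠ 3 → j ≠ 3 → x (i, j) = 0 := by
  classical
  have hcases : ∀ i : Fin 4, i = 0 ∨ i = 1 ∨ i = 2 ∨ i = 3 := by decide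
  have e00 : (0 : Fin 4).succAbove 0 = 1 := by decide
  have e01 : (0 : Fin 4).succAbove 1 = 2 := by decide
  have e02 : (0 : Fin 4).succAbove 2 = 3 := by decide
  have e10 : (1 : Fin 4).succAbove 0 = 0 := by decide
  have e11 : (1 : Fin 4).succAbove 1 = 2 := by decide
  have e12 : (1 : Fin 4).succAbove 2 = 3 := by decide
  have e20 : (2 : Fin 4).succAbove 0 = 0 := by decide
  have e21 : (2 : Fin 4).succAbove 1 = 1 := by decide
  have e22 : (2 : Fin 4).succAbove 2 = 3 := by decide
  let T : Fin 4 → (Fin 4 → K) → (Fin 4 → K) → (Fin 4 → K) → K := fun c u v w =>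
    u (c.succAbove 0) * (v (c.succAbove 1) * w (c.succAbove 2) + v (c.succAbove 2) * w (c.succAbove 1)) +
    u (c.succAbove 1) * (v (c.succAbove 0) * w (c.succAbove 2) + v (c.succAbove 2) * w (c.succAbove 0)) +
    u (c.succAbove 2) * (v (c.succAbove 0) * w (c.succAbove 1) + v (c.succAbove 1) * w (c.succAbove 0))
  let ρ : Fin 4 → (Fin 4 × Fin 4 → K) →ₗ[K] (Fin 4 → K) :=
    fun r => LinearMap.funLeft K K fun j => (r, j)
  have hρ : ∀ r x j, ρ r x j = x (r, j) := fun _ _ _ => rfl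
  have hF : ∀ y ∈ W, ∀ r₀ r₁ r₂ : Fin 4, r₀ ≠ r₁ → r₀ ≠ r₂ → r₁ ≠ r₂ → ∀ c : Fin 4,
      T c (ρ r₀ y) (ρ r₁ y) (ρ r₂ y) = 0 := by
    intro y hy r₀ r₁ r₂ h01 h02 h12 c
    have hinj : Function.Injective ![r₀, r₁, r₂] := by
      intro a b hab
      fin_cases a <;> fin_cases b <;> simp_all
    have h := hW y hy ![r₀, r₁, r₂] c.succAbove hinj Fin.succAbove_right_injective
    rw [Matrix.permanent_fin_three_row] at h
    simp only [Matrix.submatrix_apply, Matrix.of_apply, Matrix.cons_val_zero, Matrix.cons_val_one,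
      Matrix.cons_val] at h
    simp only [T, hρ]
    linear_combination h
  -- the matrix units `E_{a3}` lie in `W`
  have hE : ∀ a : Fin 4, a ≠ 3 → (Pi.single (a, (3 : Fin 4)) (1 : K) : Fin 4 × Fin 4 → K) ∈ W := by
    intro a ha
    obtain ⟨z, hzW, hz3, hzp⟩ := hz a ha
    set c := z (a, 3) with hc
    have hzeq : z = c • (Pi.single (a, (3 : Fin 4)) (1 : K) : Fin 4 × Fin 4 → K) := by
      funext p
      by_cases hp : p = (a, 3)
      · subst hp; simp [hc]
      · rw [Pi.smul_apply, Pi.single_eq_of_ne hp, smul_zero]; exact hzp p hp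
    have h := W.smul_mem c⁻¹ hzW
    rwa [hzeq, smul_smul, inv_mul_cancel₀ hz3, one_smul] at h
  -- row `3` is onto: sections `x^{(m)}`
  have hsurj : ∀ t : Fin 4 → K, ∃ x ∈ W, ρ 3 x = t := by
    intro t
    have htop : W.map (ρ 3) = ⊤ := by
      apply Submodule.eq_top_of_finrank_eq
      rw [finrank_fintype_fun_eq_card, Fintype.card_fin]
      exact hR
    have ht : t ∈ W.map (ρ 3) := by rw [htop]; exact Submodule.mem_top
    obtain ⟨x, hx, hxt⟩ := ht
    exact ⟨x, hx, hxt⟩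
  have hsec : ∀ m : Fin 4, ∃ x ∈ W, ρ 3 x = Pi.single m 1 := fun m => hsurj _
  choose xs hxsW hxs3 using hsec
  have hxs : ∀ m j, xs m (3, j) = if j = m then 1 else 0 := fun m j => by
    have := congr_fun (hxs3 m) j
    rw [hρ] at this
    rw [this, Pi.single_apply]
  -- `{x ∈ W : row_3 x = 0}` is the span of the three units, hence supported in column `3`
  have hker : ∀ y ∈ W, ρ 3 y = 0 → ∀ i j : Fin 4, j ≠ 3 → y (i, j) = 0 := by
    let f : Fin 3 → Fin 4 × Fin 4 := fun a => (Fin.castSucc a, (3 : Fin 4))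
    have hf : Function.Injective f := fun a b hab =>
      Fin.castSucc_injective _ (congrArg Prod.fst hab)
    let v : Fin 3 → (Fin 4 × Fin 4 → K) := ⇑(Pi.basisFun K (Fin 4 × Fin 4)) ∘ f
    have hv : ∀ a, v a = Pi.single (Fin.castSucc a, (3 : Fin 4)) 1 := fun a => by
      simp [v, f]
    have hli : LinearIndependent K v := (Pi.basisFun K (Fin 4 × Fin 4)).linearIndependent.comp f hf
    let C3 : Submodule K (Fin 4 × Fin 4 → K) := Submodule.span K (Set.range v)
    have hC3 : finrank K C3 = 3 := by
      rw [finrank_span_eq_card hli, Fintype.card_fin]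
    have hne3 : ∀ a : Fin 3, (Fin.castSucc a : Fin 4) ≠ 3 := fun a => (Fin.castSucc_lt_last a).ne
    have hC3le : C3 ≤ W ⊓ LinearMap.ker (ρ 3) := by
      refine Submodule.span_le.2 ?_
      rintro _ ⟨a, rfl⟩
      rw [SetLike.mem_coe, Submodule.mem_inf, LinearMap.mem_ker, hv]
      refine ⟨hE _ (hne3 a), funext fun j => ?_⟩
      rw [hρ, Pi.zero_apply, Pi.single_eq_of_ne]
      exact fun h => hne3 a (congrArg Prod.fst h).symm
    have hW' : finrank K ↥(W ⊓ LinearMap.ker (ρ 3)) = 3 := by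
      have h := finrank_eq_finrank_map_add_finrank_inf_ker W (ρ 3)
      change finrank K W = finrank K (W.map (ρ 3)) + _ at h
      change finrank K (W.map (ρ 3)) = 4 at hR
      omega
    have hCeq : C3 = W ⊓ LinearMap.ker (ρ 3) :=
      Submodule.eq_of_le_of_finrank_eq hC3le (by rw [hC3, hW'])
    intro y hy hy3 i j hj
    have hyC : y ∈ C3 := by
      rw [hCeq, Submodule.mem_inf, LinearMap.mem_ker]; exact ⟨hy, hy3⟩
    have hle : C3 ≤ LinearMap.ker (LinearMap.proj (i, j) : (Fin 4 × Fin 4 → K) →ₗ[K] K) := by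
      refine Submodule.span_le.2 ?_
      rintro _ ⟨a, rfl⟩
      rw [SetLike.mem_coe, LinearMap.mem_ker, hv, LinearMap.coe_proj, Function.eval,
        Pi.single_eq_of_ne]
      exact fun h => hj (congrArg Prod.snd h)
    exact hle hyC
  -- the three pairings between `(x_{b0}, x_{b1}, x_{b2})` and `(x_{30}, x_{31}, x_{32})`
  have hpair : ∀ x ∈ W, ∀ b : Fin 4, b ≠ 3 →
      x (b, 1) * x (3, 2) + x (b, 2) * x (3, 1) = 0 ∧
      x (b, 0) * x (3, 2) + x (b, 2) * x (3, 0) = 0 ∧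
      x (b, 0) * x (3, 1) + x (b, 1) * x (3, 0) = 0 := by
    intro x hx b hb3
    have hex : ∀ b : Fin 4, b ≠ 3 → ∃ a : Fin 4, a ≠ b ∧ a ≠ 3 := by decide
    obtain ⟨a, hab, ha3⟩ := hex b hb3
    have hEW := hE a ha3
    set E : Fin 4 × Fin 4 → K := Pi.single (a, (3 : Fin 4)) 1 with hEdef
    have hEa : ∀ j, E (a, j) = if j = 3 then 1 else 0 := fun j => by
      rw [hEdef, Pi.single_apply]; simp
    have hEb : ∀ j, E (b, j) = 0 := fun j => by
      rw [hEdef, Pi.single_eq_of_ne]; exact fun h => hab (congrArg Prod.fst h).symm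
    have hE3 : ∀ j, E (3, j) = 0 := fun j => by
      rw [hEdef, Pi.single_eq_of_ne]; exact fun h => ha3 (congrArg Prod.fst h).symm
    have k0 := hF (E + x) (W.add_mem hEW hx) a b 3 hab ha3 hb3 0
    have k1 := hF (E + x) (W.add_mem hEW hx) a b 3 hab ha3 hb3 1
    have k2 := hF (E + x) (W.add_mem hEW hx) a b 3 hab ha3 hb3 2
    have l0 := hF x hx a b 3 hab ha3 hb3 0
    have l1 := hF x hx a b 3 hab ha3 hb3 1
    have l2 := hF x hx a b 3 hab ha3 hb3 2
    simp only [T, hρ, Pi.add_apply, hEa, hEb, hE3, e00, e01, e02, e10, e11, e12, e20, e21, e22,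
      show ((1 : Fin 4) = 3) = False by decide, show ((2 : Fin 4) = 3) = False by decide,
      show ((0 : Fin 4) = 3) = False by decide, if_true, if_false, zero_add] at k0 k1 k2 l0 l1 l2
    exact ⟨by linear_combination k0 - l0, by linear_combination k1 - l1,
      by linear_combination k2 - l2⟩
  -- evaluation on the sections and their sums
  intro x hx i j hi hj
  have s0 := hpair (xs 0) (hxsW 0) i hi
  have s1 := hpair (xs 1) (hxsW 1) i hi
  have s2 := hpair (xs 2) (hxsW 2) i hi
  have s01 := hpair (xs 0 + xs 1) (W.add_mem (hxsW 0) (hxsW 1)) i hi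
  have s02 := hpair (xs 0 + xs 2) (W.add_mem (hxsW 0) (hxsW 2)) i hi
  have s12 := hpair (xs 1 + xs 2) (W.add_mem (hxsW 1) (hxsW 2)) i hi
  have s30 := hpair (xs 3 + xs 0) (W.add_mem (hxsW 3) (hxsW 0)) i hi
  have s31 := hpair (xs 3 + xs 1) (W.add_mem (hxsW 3) (hxsW 1)) i hi
  simp only [Pi.add_apply, hxs, show ((2 : Fin 4) = 0) = False by decide,
    show ((1 : Fin 4) = 0) = False by decide, show ((0 : Fin 4) = 1) = False by decide,
    show ((2 : Fin 4) = 1) = False by decide, show ((0 : Fin 4) = 2) = False by decide,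
    show ((1 : Fin 4) = 2) = False by decide, show ((0 : Fin 4) = 3) = False by decide,
    show ((1 : Fin 4) = 3) = False by decide, show ((2 : Fin 4) = 3) = False by decide,
    if_true, if_false, mul_one, mul_zero, add_zero, zero_add] at s0 s1 s2 s01 s02 s12 s30 s31
  obtain ⟨-, a02, a01⟩ := s0      -- `xs 0 (i,2) = 0`, `xs 0 (i,1) = 0`
  obtain ⟨b12, -, b10⟩ := s1      -- `xs 1 (i,2) = 0`, `xs 1 (i,0) = 0`
  obtain ⟨c21, c20, -⟩ := s2      -- `xs 2 (i,1) = 0`, `xs 2 (i,0) = 0`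
  obtain ⟨-, -, d01⟩ := s01
  obtain ⟨-, d02, -⟩ := s02
  obtain ⟨d12, -, -⟩ := s12
  obtain ⟨-, f2, f1⟩ := s30
  obtain ⟨g2, -, g0⟩ := s31
  have x00 : xs 0 (i, 0) = 0 := by
    linear_combination (d01 + d02 - d12 - a01 - b10 - a02 - c20 + c21 + b12) / 2
  have x11 : xs 1 (i, 1) = 0 := by linear_combination d01 - x00 - a01 - b10
  have x22 : xs 2 (i, 2) = 0 := by linear_combination d02 - x00 - a02 - c20
  have y1 : xs 3 (i, 1) = 0 := by linear_combination f1 - a01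
  have y2 : xs 3 (i, 2) = 0 := by linear_combination f2 - a02
  have y0 : xs 3 (i, 0) = 0 := by linear_combination g0 - b10
  -- all sections vanish at `(i, j)`
  have hsec0 : ∀ m : Fin 4, xs m (i, j) = 0 := by
    intro m
    rcases hcases m with rfl | rfl | rfl | rfl <;> rcases hcases j with rfl | rfl | rfl | rfl <;>
      first | exact absurd rfl hj | assumption
  -- `x - Σ_m x_{3m} xs m` has row `3` zero
  set y : Fin 4 × Fin 4 → K := x - ∑ m, x (3, m) • xs m with hydef
  have hyW : y ∈ W := W.sub_mem hx (W.sum_mem fun m _ => W.smul_mem _ (hxsW m))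
  have hy3 : ρ 3 y = 0 := by
    funext j'
    rw [hρ, hydef, Pi.sub_apply, Finset.sum_apply, Pi.zero_apply]
    simp only [Pi.smul_apply, smul_eq_mul, hxs, mul_ite, mul_one, mul_zero, Finset.sum_ite_eq,
      Finset.mem_univ, if_true, sub_self]
  have hyij := hker y hyW hy3 i j hj
  rw [hydef, Pi.sub_apply, Finset.sum_apply] at hyij
  simp only [Pi.smul_apply, smul_eq_mul, hsec0, mul_zero, Finset.sum_const_zero, sub_zero] at hyij
  exact hyij

end Summit.ValiantsHypothesis.ValiantsHypothesis.Theorems.SymPencilBoxFourCrossLe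

end
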